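import Mathlib
import HarnessLib
import Summits.ResolutionOfSingularities.ResolutionOfSingularities.Theorems.WildQuotientsWildQuotientResolutionJordanThreeTwoBricks
import Summits.ResolutionOfSingularities.ResolutionOfSingularities.Theorems.WildQuotientsWildQuotientResolutionJordanThreeTwoChartsKL
import Summits.ResolutionOfSingularities.ResolutionOfSingularities.Theorems.WildQuotientsWildQuotientResolutionJordanThreeTwoDivisorial
import Summits.ResolutionOfSingularities.ResolutionOfSingularities.Theorems.WildQuotientsWildQuotientResolutionJordanThreeTwoConeBrick

/-!
# N4a: every `𝔸ⁿ/(J₃ ⊕ J₂)` has a resolution of singularities (all `p ≥ 3`)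
(crux stmt-ResolutionOfSingularities-15640 `WildQuotients.WildQuotientResolution`, line `Sketch`;
chain w45c post-V5 WIDTH target N4a `JordanThreeTwo.jordanThreeTwo_hasResolution` — res-L1-w45c-stub-2
SIG 2026-08-27T14:24:14Z, res-L1-w45c-plan-1 NO OBJECTION 14:24:34Z / 15:17:58Z, CHAIN v9 §4/§5 (first
width rung after RUNG V5); [OURS · L1 W4.5c] — NOT a statement of any manuscript; replaces the role of
no printed item.)

`JordanThreeTwo.jordanThreeTwo_hasResolution`: for every field `k` of characteristic `p ≥ 3`, every
`n` and the `J₃ ⊕ J₂` datum `σ` on `k[x₁,…,xₙ]` (`σ x_b = x_b + x_a`, `σ x_c = x_c + x_b`,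
`σ x_e = x_e + x_d`, the other variables — in particular `x_a`, `x_d` — fixed: one Jordan block of size
`3`, one of size `2`, passengers), the wild quotient `Spec k[x]^⟨σ⟩` has a resolution of singularities.
Proof = the three-piece toric exit: `V = Bl_I 𝔸ⁿ`, `I = (x_a, x_b², x_bx_d, x_d²)` (the
`(2,1,1)`-weighted blow-up of the fixed subspace) with the lifted action; the Király–Lütkebohmert
pieces `⋂ g·V[x_b²]` and `V[x_d²]` (regular charts, principal stalk augmentation ideals ⇒ regular
quotient pieces) and the cone piece `V[x_a]/G ≅ ½(1,1,1) × 𝔸ⁿ⁻³` blown up once at its reduced vertex —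
assembled in `jordanThreeTwo_hasResolution_of_bricks` (res-L1-w45c-stub-2, p546956) from the bricks
`Hregb`/`Hregd` (res-L1-w45c-stub-3 `…ChartsKL`), `Hdivb`/`Hdivd` (res-L1-w45c-stub-3 `…Divisorial`,
p544113) and the cone brick `HPa` (res-L1-w45c-stub-2 `…ConeBrick`, over res-D-pv-033's seam p546684).
WORDING OF RECORD (director-resolution 01:13:17Z pattern): a resolution for this family is expected
from Király–Lütkebohmert-type arguments plus one toric step; no claim of novelty in print is made
here; AI-written, kernel-checked, weaker than expert review.
-/

-- single-problem summit: the doubled namespace component `ResolutionOfSingularities` is forced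
set_option linter.dupNamespace false

noncomputable section

open CategoryTheory AlgebraicGeometry TopologicalSpace MvPolynomial
open Literature.AlgebraicGeometry.Resolution Literature.AlgebraicGeometry.RelativeSpec

namespace Summit.ResolutionOfSingularities.ResolutionOfSingularities.Theorems.WildQuotientResolution.JordanThreeTwo

-- the brick types are long literal binders; elaboration of the plugs needs head-room
set_option maxHeartbeats 1600000 in
/-- **N4a `jordanThreeTwo_hasResolution`**: the wild quotient singularity `𝔸ⁿ/(J₃ ⊕ J₂)` (one Jordan
block of size three, one of size two, plus passengers; characteristic `p ≥ 3`, any field) has a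
resolution of singularities. [OURS · L1 W4.5c] [folklore; assembly of landed decls] -/
theorem jordanThreeTwo_hasResolution (p : ℕ) (hp : p.Prime) (hp3 : 3 ≤ p) (k : Type) [Field k]
    [CharP k p] (n : ℕ) (σ : MvPolynomial (Fin n) k ≃ₐ[k] MvPolynomial (Fin n) k) (a b c d e : Fin n)
    (hab : a ≠ b) (hac : a ≠ c) (had : a ≠ d) (hae : a ≠ e) (hbc : b ≠ c) (hbd : b ≠ d)
    (hbe : b ≠ e) (hcd : c ≠ d) (hce : c ≠ e) (hde : d ≠ e)
    (hb : σ (X b) = X b + X a) (hc : σ (X c) = X c + X b) (he : σ (X e) = X e + X d)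
    (hσ : ∀ i, i ≠ b → i ≠ c → i ≠ e → σ (X i) = X i) :
    Scheme.HasResolution
      (Spec (.of (FixedPoints.subalgebra k (MvPolynomial (Fin n) k) (Subgroup.zpowers σ)))) := by
  haveI : Fact (Nat.Prime p) := ⟨hp⟩
  have hσp : σ ^ p = 1 :=
    pow_prime_eq_one k n σ a b c d e hab hac hae hbd hcd hde hb hc he hσ p hp hp3
  haveI : Finite ↥(Subgroup.zpowers σ) := Nat.finite_of_card_ne_zero (by
    rw [Nat.card_zpowers, orderOf_eq_prime hσp (JordanThree.ne_one k n σ a b hb)]; exact hp.ne_zero)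
  exact jordanThreeTwo_hasResolution_of_bricks k n a b d p hp hp3 σ c e hab hac hae hbd hcd hde hb hc he
    hσ (isRegularLocalRing_stalk_of_mem_blowupChart k n a b d hab had hbd 1 (Or.inl rfl))
    (isRegularLocalRing_stalk_of_mem_blowupChart k n a b d hab had hbd 3 (Or.inr rfl))
    (fun ρ hρ hJ g v hv hv1 => isPrincipal_stalkAug_liftAction_of_mem_blowupChart p hp hp3 k n σ a b c
      d e hab hac hae hbd hcd hde hb hc he hσ _ rfl ρ hρ hJ g v hv 1 (Or.inl rfl) hv1)
    (fun ρ hρ hJ g v hv hv3 => isPrincipal_stalkAug_liftAction_of_mem_blowupChart p hp hp3 k n σ a b c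
      d e hab hac hae hbd hcd hde hb hc he hσ _ rfl ρ hρ hJ g v hv 3 (Or.inr rfl) hv3)
    (jordanThreeTwo_coneBrick k n a b d p hp hp3 σ c e hab hac had hae hbc hbd hbe hcd hce hde hb hc he hσ)

end Summit.ResolutionOfSingularities.ResolutionOfSingularities.Theorems.WildQuotientResolution.JordanThreeTwo

end
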